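import Summits.QuantumFields.YangMills.Theorems.BalabanUVNodesClustersCore
import Literature.MathematicalPhysics.QuantumFieldTheory.Balaban1983to89.T4FiniteEpsInhabited

/-!
# YM-DAG node N27, the EXTRACTION STUB `S_N27x` AT THE SPINE CARRIERS: the K5 stub `YMDAG.UVSplit.S_N27x Rec SRec` of the landed cut
# (`BalabanUVNodesClustersCore` p416552) — (W2) readings, closers (every-bare-sequence and carrier-FUNCTION readings), and the LOCATED A2 TRAP
# «WATCH-N27-SINGLETON» in kernel form: the one-class Wilson expansion satisfies `S_N27x` at EVERY record predicate, and on it N19's leaf `Spine.NE7.Core`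
# IS N19's own target `T4CauchySum.MatchingModConstants` for the partition functions themselves (NE7 whole)
# (cell `pub-ymgap`, HUMAN RULING D-0062 Track A, seat `pub-ymgap-dag-n27-a` g4; `--supports stmt-QuantumFields-19182`, count-neutral)

THE STUB.  `S_N27x Rec SRec := ∀ F D w, Rec F D w → (B) → END → ForSmallCouplings D (g₀ ↦ ∀ os, ∃ S, SRec F D g₀ os S ∧ 0 < S.l₀ ∧ 0 < S.vol ∧ E1 ∧ E2)` — «the
term-class expansion of record EXISTS under the pins, its class sums being the string's Wilson-normalised dressed partition functions after `S.K₀ + K` resp.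
`S.K₀ + K + 1` steps on `|t| ≤ S.l₀`» (the extraction step; in-edges N11–N13, the R-operation's term format; NOT PRINTED for loop variables — [Balaban1989LargeFieldII]
p. 356 defers them).  No carrier of record exists in the tree (NODE 00 ₉⁺ ∕ NODE O); this is the last K5 slot without a (W2) face (N19 ∕ N20 ∕ N21 have theirs).

WHAT THIS MODULE IS ([bookkeeping] ∕ [folklore]; 0 `def`, 0 `sorry`).
* §1 READINGS: `s_N27x_iff` (`Iff.rfl`); `carriers_at_record` (consumer face).  Variance in the parameters is `…N27SpineRecord.s_N27x_mono` (XII p418134: antitone in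
  `Rec`, MONOTONE in `SRec`) — cited, not restated.
* §2 CLOSERS: `s_N27x_of_forall` (carriers with positivity and E1∕E2 for EVERY bare sequence and string ⇒ `S_N27x` at every `Rec`; `ForSmallCouplings.of_forall`);
  `s_N27x_of_functionReading` (the natural shape of a definition of record: `SRec` contains the graph of a carrier FUNCTION `Sof F D g₀ os` whose values have
  positive radius ∕ volume letter and satisfy E1∕E2).
* §3 GUARDS ∕ THE LOCATED A2 TRAP: `core_singleton_iff_matchingModConstants` (for positive `Z`: `Core l₀ vol {()} ∅ (Z K) (Z (K+1)) δ ↔ MatchingModConstants vol l₀ δ Z`);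
**`coreEdge_singleton_iff_matchingModConstants`** (at that bundle the ∃δ-edge XII asks of N19 ⟺ `∃ δ, MatchingModConstants 1 1 δ (schemeZ …) ∧ Summable δ`);
  **`s_N27x_fires_on_singleton`** (for EVERY `Rec`, the carrier predicate pinning the SINGLETON Wilson expansion — one class per cutoff carrying `schemeZ` itself,
  `Bad = ∅`, zero shells ∕ weights ∕ remainder, `l₀ = vol = 1` — is inhabited at every `(F, D, g₀, os)` and satisfies `S_N27x Rec SRec`: the stub ALONE is
  junk-satisfiable; on that bundle N20 ∕ N21 are free (`N20AtSpineCarriers.s_N20_of_noBadReading`, `N21AtSpineCarriers.s_N21_of_zeroShellReading`) and N19's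
  ∃δ-edge is, by the first theorem, `∃ δ, MatchingModConstants 1 1 δ (schemeZ (D.scheme g₀) os) ∧ Summable δ` = NE7 for the partition functions — the whole
  spine content; READING FOR THE `SRec` AUTHOR: the classes of record are Bałaban's R-operation history classes, never the one-class expansion);
  `not_s_N27x_of_admits` (R422 at node level); `s_N27x_of_notB` (vacuity source located: the (B) antecedent).

HONEST FRAMING.  Bookkeeping over PARAMETERS; no expansion of Bałaban's is constructed; the singleton bundle is a TYPING witness (degenerate by design, said so),
not an object of record; nothing of Bałaban's asserted; N27 NOT discharged; typed 28∕28, count untouched; one finite four-torus programme at fixed `ε` — NOT ℝ⁴,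
NOT infinite volume, NOT OS, NOT a mass gap, NOT Clay.  Restate-immune.  No decl below carries a cite tag.
-/

open Finset

namespace Summit.QuantumFields.YangMills.Theorems.N27xAtSpineCarriers

open Literature.MathematicalPhysics.QuantumFieldTheory.Balaban1983to89
open Literature.MathematicalPhysics.QuantumFieldTheory.Balaban1983to89.T4Continuum
open T4ContinuumYM4Torus (ForSmallCouplings)
open T4CauchySum (MatchingModConstants)
open Summit.QuantumFields.BalabanUV.T4Continuum.Spine
open YMDAG.UVSplit (Datum RecordPred SpineCarriers SpineRecordPred S_N27x)

variable {N : ℕ} [NeZero N]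

/-! ## §1 (W2) readings -/

/-- **What `S_N27x Rec SRec` says** (`Iff.rfl`). [bookkeeping] -/
theorem s_N27x_iff (Rec : RecordPred N) (SRec : SpineRecordPred N) :
    S_N27x Rec SRec ↔ ∀ (F : T4Family) (D : Datum F N) (w : DagBinding.WorldP), Rec F D w →
      B16.EndStatementBPrinted D.C → DagBinding.EndpointExistence D.C.toB12 →
        ForSmallCouplings D fun g₀ => ∀ os : List (ULoop F), ∃ S : SpineCarriers,
          SRec F D g₀ os S ∧ 0 < S.l₀ ∧ 0 < S.vol ∧
            (∀ (K : ℕ) (t : ℝ), |t| ≤ S.l₀ →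
              T4GenFunBounds.schemeZ (D.scheme g₀) os (S.K₀ + K) t = ∑ τ ∈ S.T K, S.A K t τ) ∧
            (∀ (K : ℕ) (t : ℝ), |t| ≤ S.l₀ →
              T4GenFunBounds.schemeZ (D.scheme g₀) os (S.K₀ + K + 1) t = ∑ τ ∈ S.T K, S.B K t τ) :=
  Iff.rfl

/-- **Consumer face**: at a record pair, under (B) and END, the carriers of record with their dictionary, for all small-coupling tuned runs. [bookkeeping] -/
theorem carriers_at_record {Rec : RecordPred N} {SRec : SpineRecordPred N} (h : S_N27x Rec SRec)
    {F : T4Family} {D : Datum F N} {w : DagBinding.WorldP} (hR : Rec F D w)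
    (hB : B16.EndStatementBPrinted D.C) (hEnd : DagBinding.EndpointExistence D.C.toB12) :
    ForSmallCouplings D fun g₀ => ∀ os : List (ULoop F), ∃ S : SpineCarriers,
      SRec F D g₀ os S ∧ 0 < S.l₀ ∧ 0 < S.vol ∧
        (∀ (K : ℕ) (t : ℝ), |t| ≤ S.l₀ → T4GenFunBounds.schemeZ (D.scheme g₀) os (S.K₀ + K) t = ∑ τ ∈ S.T K, S.A K t τ) ∧
        (∀ (K : ℕ) (t : ℝ), |t| ≤ S.l₀ → T4GenFunBounds.schemeZ (D.scheme g₀) os (S.K₀ + K + 1) t = ∑ τ ∈ S.T K, S.B K t τ) :=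
  h F D w hR hB hEnd

/-! ## §2 (W2) closers -/

/-- **`S_N27x` FROM CARRIERS WITH THE DICTIONARY AT EVERY BARE SEQUENCE** (no pins needed; thresholds trivial, `ForSmallCouplings.of_forall`): if for every
family, datum, bare sequence and string some bundle of `SRec` has positive radius ∕ volume letter and E1∕E2, then `S_N27x Rec SRec` for EVERY `Rec`.
[bookkeeping] -/
theorem s_N27x_of_forall (Rec : RecordPred N) (SRec : SpineRecordPred N)
    (h : ∀ (F : T4Family) (D : Datum F N) (g₀ : ℕ → ℝ) (os : List (ULoop F)), ∃ S : SpineCarriers,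
      SRec F D g₀ os S ∧ 0 < S.l₀ ∧ 0 < S.vol ∧
        (∀ (K : ℕ) (t : ℝ), |t| ≤ S.l₀ → T4GenFunBounds.schemeZ (D.scheme g₀) os (S.K₀ + K) t = ∑ τ ∈ S.T K, S.A K t τ) ∧
        (∀ (K : ℕ) (t : ℝ), |t| ≤ S.l₀ → T4GenFunBounds.schemeZ (D.scheme g₀) os (S.K₀ + K + 1) t = ∑ τ ∈ S.T K, S.B K t τ)) :
    S_N27x Rec SRec :=
  fun F D _ _ _ _ => ForSmallCouplings.of_forall fun g₀ os => h F D g₀ os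

/-- **`S_N27x` FOR EVERY CARRIER-FUNCTION READING** — the natural shape of a definition of record: a FUNCTION `Sof F D g₀ os` (the expansion of the run's dressed
densities for the string `os`) whose graph lies in `SRec`, with positive radius ∕ volume letter and the E1∕E2 dictionary as properties of the function, gives
`S_N27x Rec SRec` at every `Rec`. [bookkeeping] -/
theorem s_N27x_of_functionReading (Rec : RecordPred N) (SRec : SpineRecordPred N)
    (Sof : ∀ (F : T4Family), Datum F N → (ℕ → ℝ) → List (ULoop F) → SpineCarriers)
    (hS : ∀ (F : T4Family) (D : Datum F N) (g₀ : ℕ → ℝ) (os : List (ULoop F)), SRec F D g₀ os (Sof F D g₀ os))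
    (hl₀ : ∀ (F : T4Family) (D : Datum F N) (g₀ : ℕ → ℝ) (os : List (ULoop F)), 0 < (Sof F D g₀ os).l₀)
    (hvol : ∀ (F : T4Family) (D : Datum F N) (g₀ : ℕ → ℝ) (os : List (ULoop F)), 0 < (Sof F D g₀ os).vol)
    (hE1 : ∀ (F : T4Family) (D : Datum F N) (g₀ : ℕ → ℝ) (os : List (ULoop F)) (K : ℕ) (t : ℝ), |t| ≤ (Sof F D g₀ os).l₀ →
      T4GenFunBounds.schemeZ (D.scheme g₀) os ((Sof F D g₀ os).K₀ + K) t = ∑ τ ∈ (Sof F D g₀ os).T K, (Sof F D g₀ os).A K t τ)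
    (hE2 : ∀ (F : T4Family) (D : Datum F N) (g₀ : ℕ → ℝ) (os : List (ULoop F)) (K : ℕ) (t : ℝ), |t| ≤ (Sof F D g₀ os).l₀ →
      T4GenFunBounds.schemeZ (D.scheme g₀) os ((Sof F D g₀ os).K₀ + K + 1) t = ∑ τ ∈ (Sof F D g₀ os).T K, (Sof F D g₀ os).B K t τ) :
    S_N27x Rec SRec :=
  s_N27x_of_forall Rec SRec fun F D g₀ os =>
    ⟨Sof F D g₀ os, hS F D g₀ os, hl₀ F D g₀ os, hvol F D g₀ os, hE1 F D g₀ os, hE2 F D g₀ os⟩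

/-! ## §3 Guards and the located A2 trap «WATCH-N27-SINGLETON» -/

/-- One real-variable step: for `0 < P, Q`, the core sandwich `e^{c − v}·P ≤ Q ≤ e^{c + v}·P` IS `|log Q − log P − c| ≤ v`. [folklore] -/
theorem sandwich_iff_abs_log {P Q c v : ℝ} (hP : 0 < P) (hQ : 0 < Q) :
    (Real.exp (c - v) * P ≤ Q ∧ Q ≤ Real.exp (c + v) * P) ↔ |Real.log Q - Real.log P - c| ≤ v := by
  have hQP : 0 < Q / P := div_pos hQ hP
  have hlog : Real.log (Q / P) = Real.log Q - Real.log P := Real.log_div hQ.ne' hP.ne'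
  have h1 : Real.exp (c - v) * P ≤ Q ↔ c - v ≤ Real.log Q - Real.log P := by
    rw [← le_div_iff₀ hP, ← hlog, Real.le_log_iff_exp_le hQP]
  have h2 : Q ≤ Real.exp (c + v) * P ↔ Real.log Q - Real.log P ≤ c + v := by
    rw [← div_le_iff₀ hP, ← hlog, Real.log_le_iff_le_exp hQP]
  rw [h1, h2, abs_le]
  constructor
  · rintro ⟨ha, hb⟩; constructor <;> linarith
  · rintro ⟨ha, hb⟩; constructor <;> linarith

/-- **ON THE ONE-CLASS EXPANSION, N19's LEAF IS N19's OWN TARGET FOR THE PARTITION FUNCTIONS.**  For a positive family `Z K t` (`|t| ≤ l₀`):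
`Spine.NE7.Core l₀ vol (fun _ => {()}) (fun _ _ => ∅) (fun K t _ => Z K t) (fun K t _ => Z (K+1) t) δ ↔ T4CauchySum.MatchingModConstants vol l₀ δ Z` — the core
sandwich on the single good class is matching-mod-constants of consecutive partition functions (`sandwich_iff_abs_log`).  With `Z := schemeZ (D.scheme g₀) os` this
is NE7 whole: the singleton reading relocates the entire spine content into N19's edge. [folklore] -/
theorem core_singleton_iff_matchingModConstants {l₀ vol : ℝ} {Z : ℕ → ℝ → ℝ} {δ : ℕ → ℝ}
    (hZ : ∀ (K : ℕ) (t : ℝ), |t| ≤ l₀ → 0 < Z K t) :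
    NE7.Core l₀ vol (fun _ => ({()} : Finset Unit)) (fun _ _ => ∅) (fun K t _ => Z K t) (fun K t _ => Z (K + 1) t) δ ↔
      MatchingModConstants vol l₀ δ Z := by
  refine forall_congr' fun K => exists_congr fun c => forall_congr' fun t => forall_congr' fun ht => ?_
  constructor
  · intro h
    exact (sandwich_iff_abs_log (hZ K t ht) (hZ (K + 1) t ht)).mp (h () (by simp))
  · intro h τ _
    exact (sandwich_iff_abs_log (hZ K t ht) (hZ (K + 1) t ht)).mpr h

/-- **THE LOCATED A2 TRAP «WATCH-N27-SINGLETON»: `S_N27x` ALONE IS JUNK-SATISFIABLE AT EVERY RECORD PREDICATE.**  For EVERY `Rec`, the carrier predicate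
pinning, at `(D, g₀, os)`, the SINGLETON Wilson expansion — one class per cutoff whose run-A ∕ run-B weights ARE `schemeZ (D.scheme g₀) os K t` ∕
`schemeZ … (K + 1) t`, `Bad = ∅`, zero shells, zero weight slots, zero remainder, `l₀ = vol = 1`, `K₀ = 0` — is INHABITED at every `(F, D, g₀, os)` (displayed
bundle) and satisfies `S_N27x Rec SRec` (E1∕E2 by `Finset.sum_singleton`, thresholds trivial).  So the stub's text does not protect it against this junk; what
protects cluster K5 is that the SAME bundle feeds N20 ∕ N21 ∕ N19: there N20 and N21 are free and N19's ∃δ-edge is, by `core_singleton_iff_matchingModConstants`,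
matching-mod-constants of the partition functions with a summable remainder — NE7 itself.  A TYPING witness, degenerate by design; NOT an object of record.
[bookkeeping] -/
theorem s_N27x_fires_on_singleton (Rec : RecordPred N) :
    let SRec : SpineRecordPred N := fun _ D g₀ os S =>
      S = { ι := Unit, l₀ := 1, vol := 1, K₀ := 0, T := fun _ => {()},
            A := fun K t _ => T4GenFunBounds.schemeZ (D.scheme g₀) os K t,
            B := fun K t _ => T4GenFunBounds.schemeZ (D.scheme g₀) os (K + 1) t,
            shA := fun _ _ _ => 0, shB := fun _ _ _ => 0, Bad := fun _ _ => ∅,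
            W := fun _ => 0, Wsh := fun _ => 0, δ := fun _ => 0 }
    (∀ (F : T4Family) (D : Datum F N) (g₀ : ℕ → ℝ) (os : List (ULoop F)), ∃ S : SpineCarriers, SRec F D g₀ os S) ∧
      S_N27x Rec SRec := by
  refine ⟨fun F D g₀ os => ⟨_, rfl⟩, s_N27x_of_forall Rec _ fun F D g₀ os => ⟨_, rfl, one_pos, one_pos, ?_, ?_⟩⟩
  · intro K t _
    show T4GenFunBounds.schemeZ (D.scheme g₀) os (0 + K) t = ∑ τ ∈ ({()} : Finset Unit), T4GenFunBounds.schemeZ (D.scheme g₀) os K t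
    rw [Finset.sum_singleton, zero_add]
  · intro K t _
    show T4GenFunBounds.schemeZ (D.scheme g₀) os (0 + K + 1) t =
      ∑ τ ∈ ({()} : Finset Unit), T4GenFunBounds.schemeZ (D.scheme g₀) os (K + 1) t
    rw [Finset.sum_singleton, zero_add]

/-- **… AND ON THAT BUNDLE N19's ∃δ-EDGE IS NE7 FOR THE PARTITION FUNCTIONS.**  At the singleton bundle of `s_N27x_fires_on_singleton` (shells `0`, `Bad = ∅`,
`l₀ = vol = 1`), the ∃δ-edge conclusion XII's `spine_of_coreEdge` asks of N19 — `∃ δ, Spine.NE7.Core S.l₀ S.vol S.T S.Bad (A − shA) (B − shB) δ ∧ Summable δ` — is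
EQUIVALENT to `∃ δ, T4CauchySum.MatchingModConstants 1 1 δ (schemeZ (D.scheme g₀) os) ∧ Summable δ`, i.e. to matching-mod-constants of the string's dressed
partition functions with a summable remainder (N19's DECL target `T4CauchySum.MatchingModConstants … ∧ Summable δ` at `vol = l₀ = 1`), whenever the partition
functions are positive on the source window (`T4GenFunConverse.schemeZ_pos` for data with measurable bounded observables).  The junk road's whole content sits
in this one hypothesis. [bookkeeping] -/
theorem coreEdge_singleton_iff_matchingModConstants {F : T4Family} (D : Datum F N) (g₀ : ℕ → ℝ) (os : List (ULoop F))
    (hZ : ∀ (K : ℕ) (t : ℝ), |t| ≤ 1 → 0 < T4GenFunBounds.schemeZ (D.scheme g₀) os K t) :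
    (∃ δ : ℕ → ℝ, NE7.Core (1 : ℝ) 1 (fun _ => ({()} : Finset Unit)) (fun _ _ => ∅)
        (fun K t τ => (fun K t (_ : Unit) => T4GenFunBounds.schemeZ (D.scheme g₀) os K t) K t τ - (fun _ _ (_ : Unit) => (0 : ℝ)) K t τ)
        (fun K t τ => (fun K t (_ : Unit) => T4GenFunBounds.schemeZ (D.scheme g₀) os (K + 1) t) K t τ - (fun _ _ (_ : Unit) => (0 : ℝ)) K t τ)
        δ ∧ Summable δ) ↔
      ∃ δ : ℕ → ℝ, MatchingModConstants 1 1 δ (fun K t => T4GenFunBounds.schemeZ (D.scheme g₀) os K t) ∧ Summable δ := by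
  simp only [sub_zero]
  exact exists_congr fun δ => and_congr_left fun _ => core_singleton_iff_matchingModConstants (vol := 1) hZ

/-- **The types of the prefix are inhabited**: a four-torus family and an `SU(N)` datum on it exist (`T4FiniteEpsInhabited.nonempty_finiteEpsData_SU`), so the
trap's `∀ F D g₀ os` is not over an empty domain. [bookkeeping] -/
theorem exists_family_and_datum : ∃ F : T4Family, Nonempty (Datum F N) :=
  ⟨⟨13, ⟨⟨6, rfl⟩, by norm_num⟩, by norm_num, 1, le_rfl⟩, T4FiniteEpsInhabited.nonempty_finiteEpsData_SU _ N⟩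

/-- **R422 AT NODE LEVEL**: a record pair at which (B) and END hold but, for NO thresholds, all small-coupling tuned runs carry bundles of record with the
dictionary, refutes `S_N27x`. [bookkeeping] -/
theorem not_s_N27x_of_admits (Rec : RecordPred N) (SRec : SpineRecordPred N)
    (h : ∃ (F : T4Family) (D : Datum F N) (w : DagBinding.WorldP), Rec F D w ∧ B16.EndStatementBPrinted D.C ∧
      DagBinding.EndpointExistence D.C.toB12 ∧
      ¬ ForSmallCouplings D fun g₀ => ∀ os : List (ULoop F), ∃ S : SpineCarriers,
          SRec F D g₀ os S ∧ 0 < S.l₀ ∧ 0 < S.vol ∧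
            (∀ (K : ℕ) (t : ℝ), |t| ≤ S.l₀ → T4GenFunBounds.schemeZ (D.scheme g₀) os (S.K₀ + K) t = ∑ τ ∈ S.T K, S.A K t τ) ∧
            (∀ (K : ℕ) (t : ℝ), |t| ≤ S.l₀ → T4GenFunBounds.schemeZ (D.scheme g₀) os (S.K₀ + K + 1) t = ∑ τ ∈ S.T K, S.B K t τ)) :
    ¬ S_N27x Rec SRec := by
  rintro hS
  obtain ⟨F, D, w, hR, hB, hEnd, hn⟩ := h
  exact hn (hS F D w hR hB hEnd)

/-- **VACUITY SOURCE, LOCATED — THE (B) ANTECEDENT**: at a record predicate all of whose data FAIL the pinned end statement (B), `S_N27x` holds with no content.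
(So does every K4∕K5 stub under the pins; the cure is NODE 00's (B) at the record = binder B2 ∕ node N24, not this file.) [bookkeeping] -/
theorem s_N27x_of_notB (Rec : RecordPred N) (SRec : SpineRecordPred N)
    (h : ∀ (F : T4Family) (D : Datum F N) (w : DagBinding.WorldP), Rec F D w → ¬ B16.EndStatementBPrinted D.C) :
    S_N27x Rec SRec :=
  fun F D w hR hB _ => absurd hB (h F D w hR)

end Summit.QuantumFields.YangMills.Theorems.N27xAtSpineCarriers
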